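import Summits.Ventures.Crystal3D.StickySpheres.ContactGraphRules
import HarnessLib

/-!
# The enumeration filters in the generality the engine uses them:
# ANY two balls have at most five common touching neighbours, ANY three have at most two

Venture `Crystal3D` (cell `pub-crystal3d`, seat p2), continuation of `StickySpheres/ContactGraphRules.lean`, answering the
lead's request (INBOX 05:11Z): engine-1's `pair5` filter rejects any two DISTINCT vertices (adjacent or not) with more than
five common neighbours, and `triple2` rejects any three distinct vertices with three common neighbours (`K_{3,3}`-freeness);
`ContactGraphRules.lean` proved only the touching-pair / contact-triangle forms.

HONEST FRAMING: elementary Euclidean geometry (radius-`1` balls, contact = distance `2`; corollaries in the cell's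
diameter-`1` vocabulary). Nothing enumerative, nothing about crystallization.

* `no_six_common_neighbours_of_norm` — if `‖v‖ ≥ 2` (two non-overlapping balls at `0` and `v`, touching OR NOT), there are
  no six distinct points at distance `2` from both `0` and `v` and pairwise `≥ 2` apart. (They lie on a circle of radius
  `r`, `r² = 4 − ‖v‖²/4 ≤ 3`, at pairwise central angles with cosine `≤ 1 − 2/r² ≤ 1/3`, i.e. `> π/3`.)
* `common_three_le_two` — for three DISTINCT centres `a, b, c` and any `R`, at most two points are at distance `R` from all
  three (non-collinear: linear algebra in `ℝ³`; collinear: no such point at all).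
* Corollaries `card_common_contactNeighbors_le_five'` (any `i ≠ j`) and `card_common_contactNeighbors_three_le_two'`
  (any distinct `i, j, l`) for `IsUnitPacking`.
-/

noncomputable section

open Real Finset RealInnerProductSpace

namespace Summit.Ventures.Crystal3D

open Literature.Geometry.DiscreteGeometry (exists_orthonormalBasis_third_eq inner_eq_sum_three eq_of_inner_basis_eq)

/-! ### 1. Polar coordinates on a circle of radius `r` -/

/-- If `X² + Y² = r²` with `0 ≤ r` and `θ = arg (X + iY)`, then `X = r cos θ`, `Y = r sin θ`. [folklore] -/
theorem eq_mul_cos_sin_arg {X Y r : ℝ} (hr : 0 ≤ r) (h : X ^ 2 + Y ^ 2 = r ^ 2) :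
    X = r * cos (Complex.arg ⟨X, Y⟩) ∧ Y = r * sin (Complex.arg ⟨X, Y⟩) := by
  have hn : ‖(⟨X, Y⟩ : ℂ)‖ = r := by
    rw [Complex.norm_def, Complex.normSq_mk, show X * X + Y * Y = r ^ 2 by rw [← h]; ring, Real.sqrt_sq hr]
  refine ⟨?_, ?_⟩
  · have := Complex.norm_mul_cos_arg ⟨X, Y⟩
    rw [hn] at this; exact this.symm
  · have := Complex.norm_mul_sin_arg ⟨X, Y⟩
    rw [hn] at this; exact this.symm

/-! ### 2. Any pair: at most five common touching neighbours -/

/-- **No six common neighbours of ANY pair (centred form).** Let `‖v‖ ≥ 2`. There are no six distinct points of `S²(2)`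
at distance `2` from `v` and pairwise at distance `≥ 2`. [folklore] -/
theorem no_six_common_neighbours_of_norm {v : EuclideanSpace ℝ (Fin 3)} (hv : 2 ≤ ‖v‖)
    (u : Fin 6 → EuclideanSpace ℝ (Fin 3)) (hinj : Function.Injective u)
    (hn : ∀ k, ‖u k‖ = 2) (hd : ∀ k, dist (u k) v = 2) (hsep : ∀ i j, i ≠ j → 2 ≤ dist (u i) (u j)) :
    False := by
  set D := ‖v‖ with hD
  have hD0 : 0 < D := by linarith
  -- frame with third vector v/D (apply the tree lemma to (2/D) • v, of norm 2)
  obtain ⟨b, hb⟩ := exists_orthonormalBasis_third_eq (v := (2 / D) • v)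
    (by rw [norm_smul, Real.norm_eq_abs, abs_of_pos (by positivity), ← hD]; field_simp)
  have hb2 : b 2 = (1 / D) • v := by rw [hb, smul_smul]; congr 1; field_simp
  -- ⟪u k, v⟫ = D²/2
  have huv : ∀ k, ⟪u k, v⟫ = D ^ 2 / 2 := by
    intro k
    have h1 : ‖u k - v‖ ^ 2 = 4 := by rw [← dist_eq_norm, hd k]; norm_num
    rw [norm_sub_sq_real, hn k, ← hD] at h1
    nlinarith
  have hZ : ∀ k, ⟪b 2, u k⟫ = D / 2 := by
    intro k
    rw [hb2, real_inner_smul_left, real_inner_comm, huv k]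
    field_simp
  set X : Fin 6 → ℝ := fun k => ⟪b 0, u k⟫ with hXdef
  set Y : Fin 6 → ℝ := fun k => ⟪b 1, u k⟫ with hYdef
  -- r² = 4 − D²/4
  have hXY : ∀ k, X k ^ 2 + Y k ^ 2 = 4 - D ^ 2 / 4 := by
    intro k
    have h4 : ⟪u k, u k⟫ = 4 := by rw [real_inner_self_eq_norm_sq, hn k]; norm_num
    rw [inner_eq_sum_three b, hZ k] at h4
    simp only [hXdef, hYdef]
    nlinarith [h4]
  have hr2_nonneg : 0 ≤ 4 - D ^ 2 / 4 := by rw [← hXY 0]; positivity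
  have hr2_le : 4 - D ^ 2 / 4 ≤ 3 := by nlinarith
  -- the degenerate circle: r = 0 forces all u k equal
  rcases eq_or_lt_of_le hr2_nonneg with hr0 | hrpos
  · have hX0 : ∀ k, X k = 0 := fun k => by
      have := hXY k; rw [← hr0] at this; nlinarith [sq_nonneg (X k), sq_nonneg (Y k)]
    have hY0 : ∀ k, Y k = 0 := fun k => by
      have := hXY k; rw [← hr0] at this; nlinarith [sq_nonneg (X k), sq_nonneg (Y k)]
    have : u 0 = u 1 := by
      refine eq_of_inner_basis_eq b fun m => ?_
      fin_cases m
      · show X 0 = X 1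
        rw [hX0, hX0]
      · show Y 0 = Y 1
        rw [hY0, hY0]
      · simp only [Fin.reduceFinMk, hZ]
    exact absurd (hinj this) (by decide)
  · -- polar coordinates on the circle of radius r
    set r := Real.sqrt (4 - D ^ 2 / 4) with hrdef
    have hr : 0 < r := Real.sqrt_pos.2 hrpos
    have hrsq : r ^ 2 = 4 - D ^ 2 / 4 := Real.sq_sqrt hr2_nonneg
    set θ : Fin 6 → ℝ := fun k => Complex.arg ⟨X k, Y k⟩ with hθdef
    have hpol : ∀ k, X k = r * cos (θ k) ∧ Y k = r * sin (θ k) := fun k =>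
      eq_mul_cos_sin_arg hr.le (by rw [hrsq]; exact hXY k)
    have hdist : ∀ i j, dist (u i) (u j) ^ 2 = 2 * r ^ 2 * (1 - cos (θ i - θ j)) := by
      intro i j
      rw [dist_eq_norm, norm_sub_sq_real, hn i, hn j, inner_eq_sum_three b, hZ i, hZ j]
      obtain ⟨hXi, hYi⟩ := hpol i
      obtain ⟨hXj, hYj⟩ := hpol j
      have e1 : ⟪b 0, u i⟫ = r * cos (θ i) := hXi
      have e2 : ⟪b 1, u i⟫ = r * sin (θ i) := hYi
      have e3 : ⟪b 0, u j⟫ = r * cos (θ j) := hXj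
      have e4 : ⟪b 1, u j⟫ = r * sin (θ j) := hYj
      rw [e1, e2, e3, e4, cos_sub]
      nlinarith [hrsq, sin_sq_add_cos_sq (θ i), sin_sq_add_cos_sq (θ j)]
    have hθinj : Function.Injective θ := by
      intro i j hij
      apply hinj
      obtain ⟨hXi, hYi⟩ := hpol i
      obtain ⟨hXj, hYj⟩ := hpol j
      have hij' : θ i = θ j := hij
      refine eq_of_inner_basis_eq b fun m => ?_
      fin_cases m
      · show X i = X j
        rw [hXi, hXj, hij']
      · show Y i = Y j
        rw [hYi, hYj, hij']
      · simp only [Fin.reduceFinMk, hZ]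
    have hC : ∀ i j, i ≠ j → cos (θ i - θ j) ≤ 1 / 3 := by
      intro i j hij
      have hsq := hdist i j
      have h2 := hsep i j hij
      have h4 : (4 : ℝ) ≤ dist (u i) (u j) ^ 2 := by nlinarith
      rw [hsq] at h4
      -- 4 ≤ 2 r² (1 − cos) with r² ≤ 3 ⇒ 1 − cos ≥ 2/r² ≥ 2/3
      have hc1 : cos (θ i - θ j) ≤ 1 := cos_le_one _
      nlinarith [hrsq, hr2_le]
    -- sort and conclude as in `no_six_common_neighbours`
    have hAcard : (Finset.univ.image θ).card = 6 := by
      rw [Finset.card_image_of_injective _ hθinj, Finset.card_univ, Fintype.card_fin]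
    let e := (Finset.univ.image θ).orderEmbOfFin hAcard
    have hmem : ∀ k, ∃ i, θ i = e k := by
      intro k
      have := (Finset.univ.image θ).orderEmbOfFin_mem hAcard k
      rw [Finset.mem_image] at this
      obtain ⟨i, -, hi⟩ := this
      exact ⟨i, hi⟩
    choose π' hπ' using hmem
    refine six_sorted_angles_false (fun k => e k) e.strictMono ?_ ?_ ?_
    · show -π < e 0
      rw [← hπ' 0]; exact Complex.neg_pi_lt_arg _
    · show e 5 ≤ π
      rw [← hπ' 5]; exact Complex.arg_le_pi _
    · intro i j hij
      have hne : π' i ≠ π' j := by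
        intro h; apply hij; apply e.injective; rw [← hπ' i, ← hπ' j, h]
      rw [← hπ' i, ← hπ' j]
      exact hC _ _ hne

/-- **`pair5` in full generality (radius-1 form).** If `dist a c ≥ 2` (`a ≠ c` centres of non-overlapping balls) there are
no six distinct points at distance `2` from both `a` and `c` and pairwise `≥ 2` apart. [folklore] -/
theorem no_six_common_neighbours_of_le_dist {a c : EuclideanSpace ℝ (Fin 3)} (hac : 2 ≤ dist a c)
    (q : Fin 6 → EuclideanSpace ℝ (Fin 3)) (hinj : Function.Injective q)
    (ha : ∀ k, dist (q k) a = 2) (hc : ∀ k, dist (q k) c = 2) (hsep : ∀ i j, i ≠ j → 2 ≤ dist (q i) (q j)) : False := by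
  refine no_six_common_neighbours_of_norm (v := c - a) (by rw [← dist_eq_norm, dist_comm]; exact hac) (fun k => q k - a)
    (fun i j h => hinj (sub_left_injective h)) (fun k => by rw [← dist_eq_norm]; exact ha k)
    (fun k => by rw [dist_eq_norm, sub_sub_sub_cancel_right, ← dist_eq_norm]; exact hc k)
    (fun i j hij => by rw [dist_eq_norm, sub_sub_sub_cancel_right, ← dist_eq_norm]; exact hsep i j hij)

/-! ### 3. Any triple: at most two common neighbours -/

/-- **Three spheres of equal radius about three DISTINCT centres meet in at most two points.** If `a, b, c` are
distinct and `p₀, p₁, p₂` are each at distance `R` from `a`, `b` and `c`, then two of the `pᵢ` coincide. [folklore] -/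
theorem common_three_le_two {a b c : EuclideanSpace ℝ (Fin 3)} (hab : a ≠ b) (hac : a ≠ c) (hbc : b ≠ c) {R : ℝ}
    (p : Fin 3 → EuclideanSpace ℝ (Fin 3)) (hpa : ∀ i, dist (p i) a = R) (hpb : ∀ i, dist (p i) b = R)
    (hpc : ∀ i, dist (p i) c = R) : ¬ Function.Injective p := by
  intro hinj
  obtain ⟨w1, hw1⟩ : ∃ w1 : EuclideanSpace ℝ (Fin 3), w1 = b - a := ⟨_, rfl⟩
  obtain ⟨w2, hw2⟩ : ∃ w2 : EuclideanSpace ℝ (Fin 3), w2 = c - a := ⟨_, rfl⟩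
  obtain ⟨v, hv⟩ : ∃ v : Fin 3 → EuclideanSpace ℝ (Fin 3), ∀ i, v i = p i - a := ⟨_, fun i => rfl⟩
  have hw1ne : w1 ≠ 0 := by rw [hw1]; exact sub_ne_zero.2 (Ne.symm hab)
  have hw2ne : w2 ≠ 0 := by rw [hw2]; exact sub_ne_zero.2 (Ne.symm hac)
  have hvn : ∀ i, ‖v i‖ = R := fun i => by rw [hv, ← dist_eq_norm, hpa i]
  -- ⟪v i, w⟫ = ‖w‖²/2 for w = w1, w2
  have key : ∀ (y w : EuclideanSpace ℝ (Fin 3)) (i : Fin 3), w = y - a → dist (p i) y = R → ⟪v i, w⟫ = ‖w‖ ^ 2 / 2 := by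
    intro y w i hw hy
    have h1 : ‖v i - w‖ = R := by rw [hv, hw, sub_sub_sub_cancel_right, ← dist_eq_norm, hy]
    have e := norm_sub_sq_real (v i) w
    rw [h1, hvn i] at e
    linarith
  have hv1 : ∀ i, ⟪v i, w1⟫ = ‖w1‖ ^ 2 / 2 := fun i => key b w1 i hw1 (hpb i)
  have hv2 : ∀ i, ⟪v i, w2⟫ = ‖w2‖ ^ 2 / 2 := fun i => key c w2 i hw2 (hpc i)
  -- collinear case: impossible even for one common point
  by_cases hli : LinearIndependent ℝ ![w1, w2]
  swap
  · rw [Fintype.not_linearIndependent_iff] at hli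
    obtain ⟨g, hg, i0, hi0⟩ := hli
    simp only [Fin.sum_univ_two, Matrix.cons_val_zero, Matrix.cons_val_one] at hg
    -- g0 w1 + g1 w2 = 0 with (g0,g1) ≠ 0
    have hg1 : g 1 ≠ 0 := by
      intro h1
      have hg0 : g 0 ≠ 0 := by
        fin_cases i0
        · exact hi0
        · exact absurd h1 hi0
      rw [h1, zero_smul, add_zero] at hg
      exact hw1ne ((smul_eq_zero.mp hg).resolve_left hg0)
    -- w2 = μ w1
    set μ := -(g 0) / g 1 with hμ
    have hw2eq : w2 = μ • w1 := by
      have : g 1 • w2 = -(g 0 • w1) := eq_neg_of_add_eq_zero_right hg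
      calc w2 = (g 1)⁻¹ • (g 1 • w2) := by rw [smul_smul, inv_mul_cancel₀ hg1, one_smul]
        _ = μ • w1 := by rw [this, smul_neg, smul_smul, hμ, div_eq_mul_inv, mul_comm]; simp [neg_smul]
    have e1 := hv2 0
    rw [hw2eq, real_inner_smul_right, hv1 0, norm_smul, mul_pow, Real.norm_eq_abs, sq_abs] at e1
    have hw1n : ‖w1‖ ^ 2 ≠ 0 := by positivity
    have hμ01 : μ * (μ - 1) = 0 := by
      have : μ * ‖w1‖ ^ 2 = μ ^ 2 * ‖w1‖ ^ 2 := by linarith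
      have : (μ * (μ - 1)) * ‖w1‖ ^ 2 = 0 := by linarith
      exact (mul_eq_zero.mp this).resolve_right hw1n
    rcases mul_eq_zero.mp hμ01 with h0 | h1
    · exact hw2ne (by rw [hw2eq, h0, zero_smul])
    · have : w2 = w1 := by rw [hw2eq, show μ = 1 by linarith, one_smul]
      rw [hw1, hw2] at this
      exact hbc (sub_left_injective this).symm
  -- non-collinear case
  obtain ⟨u1, hu1⟩ : ∃ u1 : EuclideanSpace ℝ (Fin 3), u1 = v 0 - v 1 := ⟨_, rfl⟩
  obtain ⟨u2, hu2⟩ : ∃ u2 : EuclideanSpace ℝ (Fin 3), u2 = v 0 - v 2 := ⟨_, rfl⟩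
  have hu1w1 : ⟪u1, w1⟫ = 0 := by rw [hu1, inner_sub_left, hv1, hv1]; ring
  have hu1w2 : ⟪u1, w2⟫ = 0 := by rw [hu1, inner_sub_left, hv2, hv2]; ring
  have hu2w1 : ⟪u2, w1⟫ = 0 := by rw [hu2, inner_sub_left, hv1, hv1]; ring
  have hu2w2 : ⟪u2, w2⟫ = 0 := by rw [hu2, inner_sub_left, hv2, hv2]; ring
  have hn1 : 2 * ⟪v 0, u1⟫ = ⟪u1, u1⟫ := by
    have e : v 0 - u1 = v 1 := by rw [hu1]; abel
    have h := norm_sub_sq_real (v 0) u1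
    rw [e, hvn 1, hvn 0, ← real_inner_self_eq_norm_sq u1] at h
    linarith
  have hn2 : 2 * ⟪v 0, u2⟫ = ⟪u2, u2⟫ := by
    have e : v 0 - u2 = v 2 := by rw [hu2]; abel
    have h := norm_sub_sq_real (v 0) u2
    rw [e, hvn 2, hvn 0, ← real_inner_self_eq_norm_sq u2] at h
    linarith
  have hdep : ¬ LinearIndependent ℝ ![w1, w2, u1, u2] := by
    intro hli4
    have := hli4.fintype_card_le_finrank
    rw [finrank_euclideanSpace_fin, Fintype.card_fin] at this
    omega
  rw [Fintype.not_linearIndependent_iff] at hdep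
  obtain ⟨g, hg, i0, hi0⟩ := hdep
  simp only [Fin.sum_univ_four, Matrix.cons_val_zero, Matrix.cons_val_one, Matrix.cons_val] at hg
  -- z := g0 w1 + g1 w2 is orthogonal to w1, w2, hence zero, hence g0 = g1 = 0
  obtain ⟨z, hzdef⟩ : ∃ z : EuclideanSpace ℝ (Fin 3), z = g 0 • w1 + g 1 • w2 := ⟨_, rfl⟩
  have hgz : z + g 2 • u1 + g 3 • u2 = 0 := by rw [hzdef]; exact hg
  have hz1 : ⟪z, w1⟫ = 0 := by
    have e1 : ⟪z + g 2 • u1 + g 3 • u2, w1⟫ = 0 := by rw [hgz, inner_zero_left]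
    rw [inner_add_left, inner_add_left, real_inner_smul_left, real_inner_smul_left, hu1w1, hu2w1] at e1
    linarith
  have hz2 : ⟪z, w2⟫ = 0 := by
    have e2 : ⟪z + g 2 • u1 + g 3 • u2, w2⟫ = 0 := by rw [hgz, inner_zero_left]
    rw [inner_add_left, inner_add_left, real_inner_smul_left, real_inner_smul_left, hu1w2, hu2w2] at e2
    linarith
  have hz : ⟪z, z⟫ = 0 := by
    have : ⟪z, g 0 • w1 + g 1 • w2⟫ = g 0 * ⟪z, w1⟫ + g 1 * ⟪z, w2⟫ := by
      rw [inner_add_right, real_inner_smul_right, real_inner_smul_right]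
    rw [← hzdef] at this
    rw [this, hz1, hz2]; ring
  have hz0 : g 0 • w1 + g 1 • w2 = 0 := by rw [← hzdef]; exact inner_self_eq_zero.mp hz
  have hg01 : g 0 = 0 ∧ g 1 = 0 := by
    rw [Fintype.linearIndependent_iff] at hli
    have := hli ![g 0, g 1] (by simpa [Fin.sum_univ_two] using hz0)
    exact ⟨by simpa using this 0, by simpa using this 1⟩
  obtain ⟨hg0, hg1'⟩ := hg01
  rw [hg0, hg1', zero_smul, zero_smul, zero_add, zero_add] at hg
  have hg23 : g 2 ≠ 0 ∨ g 3 ≠ 0 := by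
    fin_cases i0
    · exact absurd hg0 hi0
    · exact absurd hg1' hi0
    · exact Or.inl hi0
    · exact Or.inr hi0
  have hvinj : ∀ i j, v i = v j → p i = p j := fun i j h => by
    rw [hv, hv] at h; exact sub_left_injective h
  have h01 : p 0 ≠ p 1 := fun h => absurd (hinj h) (by decide)
  have h02 : p 0 ≠ p 2 := fun h => absurd (hinj h) (by decide)
  have h12 : p 1 ≠ p 2 := fun h => absurd (hinj h) (by decide)
  have hu1ne : u1 ≠ 0 := fun h => h01 (hvinj 0 1 (sub_eq_zero.mp (by rw [← hu1]; exact h)))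
  have hu2ne : u2 ≠ 0 := fun h => h02 (hvinj 0 2 (sub_eq_zero.mp (by rw [← hu2]; exact h)))
  rcases hg23 with h2 | h3
  · have ht : u1 = (-(g 3) / g 2) • u2 := by
      have : g 2 • u1 = -(g 3 • u2) := eq_neg_of_add_eq_zero_left hg
      calc u1 = (g 2)⁻¹ • (g 2 • u1) := by rw [smul_smul, inv_mul_cancel₀ h2, one_smul]
        _ = (-(g 3) / g 2) • u2 := by rw [this, smul_neg, smul_smul, div_eq_mul_inv, mul_comm]; simp [neg_smul]
    set t := -(g 3) / g 2 with htdef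
    have hq : ⟪u2, u2⟫ ≠ 0 := by rwa [ne_eq, inner_self_eq_zero]
    have e3 : 2 * ⟪v 0, u1⟫ = t * ⟪u2, u2⟫ := by
      rw [ht, real_inner_smul_right, ← mul_assoc, mul_comm 2 t, mul_assoc, hn2]
    have e4 : ⟪u1, u1⟫ = t * t * ⟪u2, u2⟫ := by rw [ht, real_inner_smul_left, real_inner_smul_right]; ring
    have e5 : t * ⟪u2, u2⟫ = t * t * ⟪u2, u2⟫ := by rw [← e3, hn1, e4]
    have ht01 : t = 0 ∨ t = 1 := by
      have : t * (t - 1) * ⟪u2, u2⟫ = 0 := by linarith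
      rcases mul_eq_zero.mp this with h | h
      · rcases mul_eq_zero.mp h with h' | h'
        · exact Or.inl h'
        · exact Or.inr (by linarith)
      · exact absurd h hq
    rcases ht01 with h0 | h1
    · exact hu1ne (by rw [ht, h0, zero_smul])
    · apply h12
      have e : u1 = u2 := by rw [ht, h1, one_smul]
      rw [hu1, hu2] at e
      exact hvinj 1 2 (sub_right_injective e)
  · have ht : u2 = (-(g 2) / g 3) • u1 := by
      have : g 3 • u2 = -(g 2 • u1) := eq_neg_of_add_eq_zero_right hg
      calc u2 = (g 3)⁻¹ • (g 3 • u2) := by rw [smul_smul, inv_mul_cancel₀ h3, one_smul]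
        _ = (-(g 2) / g 3) • u1 := by rw [this, smul_neg, smul_smul, div_eq_mul_inv, mul_comm]; simp [neg_smul]
    set t := -(g 2) / g 3 with htdef
    have hq : ⟪u1, u1⟫ ≠ 0 := by rwa [ne_eq, inner_self_eq_zero]
    have e3 : 2 * ⟪v 0, u2⟫ = t * ⟪u1, u1⟫ := by
      rw [ht, real_inner_smul_right, ← mul_assoc, mul_comm 2 t, mul_assoc, hn1]
    have e4 : ⟪u2, u2⟫ = t * t * ⟪u1, u1⟫ := by rw [ht, real_inner_smul_left, real_inner_smul_right]; ring
    have e5 : t * ⟪u1, u1⟫ = t * t * ⟪u1, u1⟫ := by rw [← e3, hn2, e4]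
    have ht01 : t = 0 ∨ t = 1 := by
      have : t * (t - 1) * ⟪u1, u1⟫ = 0 := by linarith
      rcases mul_eq_zero.mp this with h | h
      · rcases mul_eq_zero.mp h with h' | h'
        · exact Or.inl h'
        · exact Or.inr (by linarith)
      · exact absurd h hq
    rcases ht01 with h0 | h1
    · exact hu2ne (by rw [ht, h0, zero_smul])
    · apply h12
      have e : u2 = u1 := by rw [ht, h1, one_smul]
      rw [hu1, hu2] at e
      exact hvinj 1 2 (sub_right_injective e).symm

/-! ### 4. Corollaries for unit packings (diameter `1`): the filters exactly as engine-1 applies them -/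

section UnitPacking

variable {N : ℕ} {x : Fin N → EuclideanSpace ℝ (Fin 3)}

/-- **`pair5`, general form**: in a packing of unit-diameter balls ANY two distinct balls have at most five common
touching neighbours. [folklore] -/
theorem card_common_contactNeighbors_le_five' (hx : IsUnitPacking x) {i j : Fin N} (hij : i ≠ j) :
    (contactNeighbors x i ∩ contactNeighbors x j).card ≤ 5 := by
  classical
  by_contra h
  obtain ⟨F, hF, hcard⟩ := Finset.exists_subset_card_eq
    (show 6 ≤ (contactNeighbors x i ∩ contactNeighbors x j).card by omega)
  set e := (Finset.equivFinOfCardEq hcard).symm with he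
  have hmem : ∀ k, ((e k : F) : Fin N) ∈ contactNeighbors x i ∩ contactNeighbors x j := fun k => hF (e k).2
  refine no_six_common_neighbours_of_le_dist (a := (2 : ℝ) • x i) (c := (2 : ℝ) • x j)
    (by rw [dist_two_smul]; linarith [hx.one_le_dist hij]) (fun k => (2 : ℝ) • x ((e k : F) : Fin N)) ?_ ?_ ?_ ?_
  · intro k l hkl
    have h2 : x ((e k : F) : Fin N) = x ((e l : F) : Fin N) := smul_right_injective _ (by norm_num : (2 : ℝ) ≠ 0) hkl
    exact e.injective (Subtype.val_injective (hx.injective h2))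
  · intro k
    have := (mem_contactNeighbors x).1 (Finset.mem_inter.1 (hmem k)).1
    rw [dist_two_smul, dist_comm, this.2]; norm_num
  · intro k
    have := (mem_contactNeighbors x).1 (Finset.mem_inter.1 (hmem k)).2
    rw [dist_two_smul, dist_comm, this.2]; norm_num
  · intro k l hkl
    have hne : ((e k : F) : Fin N) ≠ ((e l : F) : Fin N) := fun h' => hkl (e.injective (Subtype.val_injective h'))
    rw [dist_two_smul]
    linarith [hx.one_le_dist hne]

/-- **`triple2`, general form (`K_{3,3}`-freeness)**: in a packing of unit-diameter balls ANY three distinct balls have at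
most two common touching neighbours. [folklore] -/
theorem card_common_contactNeighbors_three_le_two' (hx : IsUnitPacking x) {i j l : Fin N}
    (hij : i ≠ j) (hil : i ≠ l) (hjl : j ≠ l) :
    (contactNeighbors x i ∩ contactNeighbors x j ∩ contactNeighbors x l).card ≤ 2 := by
  classical
  by_contra h
  obtain ⟨F, hF, hcard⟩ := Finset.exists_subset_card_eq
    (show 3 ≤ (contactNeighbors x i ∩ contactNeighbors x j ∩ contactNeighbors x l).card by omega)
  set e := (Finset.equivFinOfCardEq hcard).symm with he
  have hmem : ∀ k, ((e k : F) : Fin N) ∈ contactNeighbors x i ∩ contactNeighbors x j ∩ contactNeighbors x l :=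
    fun k => hF (e k).2
  have hi : ∀ k, dist (x ((e k : F) : Fin N)) (x i) = 1 := fun k => by
    rw [dist_comm]; exact ((mem_contactNeighbors x).1 (Finset.mem_inter.1 (Finset.mem_inter.1 (hmem k)).1).1).2
  have hj : ∀ k, dist (x ((e k : F) : Fin N)) (x j) = 1 := fun k => by
    rw [dist_comm]; exact ((mem_contactNeighbors x).1 (Finset.mem_inter.1 (Finset.mem_inter.1 (hmem k)).1).2).2
  have hl : ∀ k, dist (x ((e k : F) : Fin N)) (x l) = 1 := fun k => by
    rw [dist_comm]; exact ((mem_contactNeighbors x).1 (Finset.mem_inter.1 (hmem k)).2).2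
  refine common_three_le_two (a := x i) (b := x j) (c := x l) (fun h' => hij (hx.injective h'))
    (fun h' => hil (hx.injective h')) (fun h' => hjl (hx.injective h')) (R := 1)
    (fun k => x ((e k : F) : Fin N)) hi hj hl ?_
  intro k m hkm
  exact e.injective (Subtype.val_injective (hx.injective hkm))

end UnitPacking

end Summit.Ventures.Crystal3D

end
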